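import Literature.NumberTheory.LFunctions.BeterminSamajTravenec2021.CriticalAnisotropy
import HarnessLib

/-!
# Bétermin–Šamaj–Travěnec (2021), Conjecture 1.1: how small the counterexample value is

Companion to `CriticalAnisotropy.lean` (which refutes Conjecture 1.1 of arXiv:2110.09368v2
[BeterminSamajTravenec2021]: `ζ^{(2)}(½, e^γ/(4π)) > 0`). Here the positive value is bounded ABOVE,
certifying why 15-digit numerics could not distinguish `e^γ/(4π)` from the true edge zero:

  **`0 < ζ^{(2)}(½, e^γ/(4π)) < 10⁻¹⁸`** (`re_half_deltaStar_lt`, `norm_half_deltaStar_lt`).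

Proof. By `re_half_eq`, `ζ^{(2)}(½, e^γ/(4π)) = 2y Σ_{m,k≥1} I(πymk)` with `y = 4πe^{−γ}` and
`I(κ) = ∫₀^∞ t⁻¹e^{−κ(t+1/t)}dt ≤ √(π/κ) e^{−2κ}` (Bateman–Grosswald, Lemma 3 with `h = 0`; the
tree's `BesselK0.integral_inv_mul_exp_le`). With `q = e^{−2πy}` and `mk ≥ m + k − 1`,
`I(πymk) ≤ y^{−½} q^{m+k−1}`, so `Σ_{m,k≥1} I(πymk) ≤ y^{−½} q/(1 − q)²` (`tsum_besselIntegral_le`)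
and `ζ^{(2)}(½, e^γ/(4π)) ≤ 2√y·q/(1 − q)²` (`re_half_deltaStar_le`). Numerically `y < 7.0556`,
`√y < 2.6563`, `2πy > 44`, `q < e^{−44} < 8·10⁻²⁰` (`exp_neg_44_lt`, from `e > 2.718`), whence
`< 4.3·10⁻¹⁹ < 10⁻¹⁸`. (The true value is `2.96…·10⁻¹⁹`; not certified here.)

AI-produced formalisation for the refutations bundle `papers/_cross/refutations`, item (viii); AI
review is weaker than expert review.

## References

* L. Bétermin, L. Šamaj, I. Travěnec, arXiv:2110.09368v2, Conjecture 1.1.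
  [BeterminSamajTravenec2021]
* P. T. Bateman, E. Grosswald, *On Epstein's zeta function*, Acta Arith. 9 (1964) 365–373, Lemma 3.
  [BatemanGrosswald1964]
-/

noncomputable section

open Complex Filter Topology MeasureTheory Set

namespace Literature.NumberTheory.LFunctions.BeterminSamajTravenec2021

open Literature.Barriers.RiemannHypothesis Literature.Analysis.SpecialFunctions

/-- **Geometric majorant of the Bessel series**: for `y > 0` and `q = e^{−2πy}`,
`Σ_{m,k≥1} I(πymk) ≤ y^{−½} · q/(1 − q)²`, from `I(κ) ≤ √(π/κ)e^{−2κ}` (Bateman–Grosswald, Lemma 3),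
`√(1/(ymk)) ≤ y^{−½}` and `e^{−2πymk} ≤ q^{m+k−1}` (`mk ≥ m + k − 1`).
[cite: BatemanGrosswald1964, Lemma 3] -/
theorem tsum_besselIntegral_le {y : ℝ} (hy : 0 < y) :
    ∑' p : ℕ × ℕ, ∫ t in Ioi (0 : ℝ),
        t⁻¹ * Real.exp (-(Real.pi * y * ((p.1 : ℝ) + 1) * ((p.2 : ℝ) + 1)) * (t + t⁻¹)) ≤
      (Real.sqrt y)⁻¹ *
        (Real.exp (-(2 * Real.pi * y)) / (1 - Real.exp (-(2 * Real.pi * y))) ^ 2) := by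
  set q : ℝ := Real.exp (-(2 * Real.pi * y)) with hq
  have hq0 : 0 < q := Real.exp_pos _
  have hq1 : q < 1 := Real.exp_lt_one_iff.2 (by nlinarith [Real.pi_pos])
  have hsy : 0 < Real.sqrt y := Real.sqrt_pos.2 hy
  -- the majorant `g (a, b) = y^{−½} · q · q^a · q^b` and its sum
  have hgeo := hasSum_geometric_of_lt_one hq0.le hq1
  have hnorm : Summable fun n : ℕ => ‖q ^ n‖ := by
    simpa [norm_pow, Real.norm_eq_abs, abs_of_pos hq0] using summable_geometric_of_lt_one hq0.le hq1
  have hprod : HasSum (fun p : ℕ × ℕ => q ^ p.1 * q ^ p.2) ((1 - q)⁻¹ * (1 - q)⁻¹) :=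
    hgeo.mul hgeo (summable_mul_of_summable_norm hnorm hnorm)
  have hG : HasSum (fun p : ℕ × ℕ => (Real.sqrt y)⁻¹ * q * (q ^ p.1 * q ^ p.2))
      ((Real.sqrt y)⁻¹ * q * ((1 - q)⁻¹ * (1 - q)⁻¹)) := hprod.mul_left _
  have hGsum :
      (Real.sqrt y)⁻¹ * q * ((1 - q)⁻¹ * (1 - q)⁻¹) = (Real.sqrt y)⁻¹ * (q / (1 - q) ^ 2) := by
    have h1q : (1 - q) ≠ 0 := (sub_pos.2 hq1).ne'
    field_simp
  -- summability of the Bessel series (from `CriticalAnisotropy.tsum_besselIntegral_pos`'s proof)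
  have hsum : Summable fun p : ℕ × ℕ => 4 * Real.sqrt y * ∫ t in Ioi (0 : ℝ),
      t⁻¹ * Real.exp (-(Real.pi * y * ((p.1 : ℝ) + 1) * ((p.2 : ℝ) + 1)) * (t + t⁻¹)) := by
    refine (summable_cross_norms hy 0).congr fun p => ?_
    simp only [mul_zero, zero_mul, Real.cos_zero, abs_one, mul_one]
  have hu : Summable fun p : ℕ × ℕ => ∫ t in Ioi (0 : ℝ),
      t⁻¹ * Real.exp (-(Real.pi * y * ((p.1 : ℝ) + 1) * ((p.2 : ℝ) + 1)) * (t + t⁻¹)) := by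
    refine (hsum.mul_left (1 / (4 * Real.sqrt y))).congr fun p => ?_
    field_simp
  -- termwise comparison
  have hle : ∀ p : ℕ × ℕ, (∫ t in Ioi (0 : ℝ),
      t⁻¹ * Real.exp (-(Real.pi * y * ((p.1 : ℝ) + 1) * ((p.2 : ℝ) + 1)) * (t + t⁻¹))) ≤
      (Real.sqrt y)⁻¹ * q * (q ^ p.1 * q ^ p.2) := by
    rintro ⟨a, b⟩
    have hm : (1 : ℝ) ≤ (a : ℝ) + 1 := by simp
    have hk : (1 : ℝ) ≤ (b : ℝ) + 1 := by simp
    have hmk : (1 : ℝ) ≤ ((a : ℝ) + 1) * ((b : ℝ) + 1) := by nlinarith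
    set κ : ℝ := Real.pi * y * ((a : ℝ) + 1) * ((b : ℝ) + 1) with hκ
    have hκ0 : 0 < κ := by positivity
    have hI : (∫ t in Ioi (0 : ℝ), t⁻¹ * Real.exp (-κ * (t + t⁻¹))) ≤
        Real.sqrt (Real.pi / κ) * Real.exp (-(2 * κ)) := BesselK0.integral_inv_mul_exp_le hκ0
    have hI' : (∫ t in Ioi (0 : ℝ), t⁻¹ * Real.exp (-(Real.pi * y * ((a : ℝ) + 1) * ((b : ℝ) + 1)) *
        (t + t⁻¹))) = ∫ t in Ioi (0 : ℝ), t⁻¹ * Real.exp (-κ * (t + t⁻¹)) := by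
      simp only [hκ, neg_mul]
    rw [hI']
    refine hI.trans ?_
    -- `√(π/κ) ≤ (√y)⁻¹`
    have h1 : Real.sqrt (Real.pi / κ) ≤ (Real.sqrt y)⁻¹ := by
      rw [← Real.sqrt_inv]
      apply Real.sqrt_le_sqrt
      rw [div_le_iff₀ hκ0]
      calc Real.pi = y⁻¹ * (Real.pi * y * 1) := by field_simp
        _ ≤ y⁻¹ * (Real.pi * y * (((a : ℝ) + 1) * ((b : ℝ) + 1))) := by gcongr
        _ = y⁻¹ * κ := by rw [hκ]; ring
    -- `e^{−2κ} ≤ q · q^a · q^b = e^{−2πy(a+b+1)}`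
    have h2 : Real.exp (-(2 * κ)) ≤ q * (q ^ a * q ^ b) := by
      rw [hq, ← Real.exp_nat_mul, ← Real.exp_nat_mul, ← Real.exp_add, ← Real.exp_add,
        Real.exp_le_exp, hκ]
      have hab : (0 : ℝ) ≤ (a : ℝ) * (b : ℝ) := by positivity
      nlinarith [Real.pi_pos, mul_pos Real.pi_pos hy]
    calc Real.sqrt (Real.pi / κ) * Real.exp (-(2 * κ))
        ≤ (Real.sqrt y)⁻¹ * (q * (q ^ a * q ^ b)) :=
          mul_le_mul h1 h2 (Real.exp_pos _).le (by positivity)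
      _ = (Real.sqrt y)⁻¹ * q * (q ^ a * q ^ b) := by ring
  calc ∑' p : ℕ × ℕ, ∫ t in Ioi (0 : ℝ),
        t⁻¹ * Real.exp (-(Real.pi * y * ((p.1 : ℝ) + 1) * ((p.2 : ℝ) + 1)) * (t + t⁻¹))
      ≤ ∑' p : ℕ × ℕ, (Real.sqrt y)⁻¹ * q * (q ^ p.1 * q ^ p.2) :=
        hu.tsum_le_tsum hle hG.summable
    _ = (Real.sqrt y)⁻¹ * (q / (1 - q) ^ 2) := by rw [hG.tsum_eq, hGsum]

/-- **`ζ^{(2)}(½, e^γ/(4π)) ≤ 2√y · q/(1 − q)²`**, `y = 4πe^{−γ}`, `q = e^{−2πy}`: the exact central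
value `2y Σ_{m,k≥1} I(πymk)` (`re_half_deltaStar_eq`) under the geometric majorant. [folklore] -/
theorem re_half_deltaStar_le {F : ℂ → ℂ} (hF : IsZetaTwo deltaStar F) :
    (F (1 / 2)).re ≤ 2 * Real.sqrt (1 / deltaStar) *
      (Real.exp (-(2 * Real.pi * (1 / deltaStar))) /
        (1 - Real.exp (-(2 * Real.pi * (1 / deltaStar)))) ^ 2) := by
  have hy : 0 < 1 / deltaStar := one_div_pos.2 deltaStar_pos
  have hsy : 0 < Real.sqrt (1 / deltaStar) := Real.sqrt_pos.2 hy
  rw [re_half_deltaStar_eq hF]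
  have h := tsum_besselIntegral_le hy
  have e : (2 : ℝ) / deltaStar = 2 * Real.sqrt (1 / deltaStar) * Real.sqrt (1 / deltaStar) := by
    rw [mul_assoc, Real.mul_self_sqrt hy.le]; ring
  calc 2 * (∑' p : ℕ × ℕ, ∫ t in Ioi (0 : ℝ), t⁻¹ *
          Real.exp (-(Real.pi * (1 / deltaStar) * ((p.1 : ℝ) + 1) * ((p.2 : ℝ) + 1)) * (t + t⁻¹))) /
        deltaStar
      = 2 / deltaStar * ∑' p : ℕ × ℕ, ∫ t in Ioi (0 : ℝ), t⁻¹ *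
          Real.exp (-(Real.pi * (1 / deltaStar) * ((p.1 : ℝ) + 1) * ((p.2 : ℝ) + 1)) *
            (t + t⁻¹)) := by
        ring
    _ ≤ 2 / deltaStar * ((Real.sqrt (1 / deltaStar))⁻¹ *
          (Real.exp (-(2 * Real.pi * (1 / deltaStar))) /
            (1 - Real.exp (-(2 * Real.pi * (1 / deltaStar)))) ^ 2)) :=
        mul_le_mul_of_nonneg_left h (div_pos two_pos deltaStar_pos).le
    _ = _ := by rw [e]; field_simp

/-- `e^{−44} < 8·10⁻²⁰` (from `e > 2.718`: `2.718⁴⁴ > 1.25·10¹⁹`). [folklore] -/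
theorem exp_neg_44_lt : Real.exp (-44) < 8e-20 := by
  have h1 : (2.718 : ℝ) < Real.exp 1 := lt_trans (by norm_num) Real.exp_one_gt_d9
  have h44 : (2.718 : ℝ) ^ 44 < Real.exp 44 := by
    rw [show (44 : ℝ) = ((44 : ℕ) : ℝ) by norm_num, ← Real.exp_one_pow]
    exact pow_lt_pow_left₀ h1 (by norm_num) (by norm_num)
  have hlow : (1.25e19 : ℝ) < (2.718 : ℝ) ^ 44 := by norm_num
  rw [Real.exp_neg, inv_lt_comm₀ (Real.exp_pos _) (by norm_num)]
  calc (8e-20 : ℝ)⁻¹ = 1.25e19 := by norm_num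
    _ < Real.exp 44 := hlow.trans h44

/-- `44 ≤ 2π · 4πe^{−γ}` (`π > 3.141592`, `4πe^{−γ} > 7.0554`). [folklore] -/
theorem fortyfour_le : (44 : ℝ) ≤ 2 * Real.pi * (1 / deltaStar) := by
  have h1 := window_one_div_deltaStar.1
  have h2 := Real.pi_gt_d6
  nlinarith

/-- `√(4πe^{−γ}) < 2.6563` (`4πe^{−γ} < 7.0556 < 2.6563²`). [folklore] -/
theorem sqrt_one_div_deltaStar_lt : Real.sqrt (1 / deltaStar) < 2.6563 := by
  rw [Real.sqrt_lt' (by norm_num)]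
  exact window_one_div_deltaStar.2.trans (by norm_num)

/-- **`ζ^{(2)}(½, e^γ/(4π)) < 10⁻¹⁸`**: the value of (the analytic continuation of)
`ζ^{(2)}(·, e^γ/(4π))` at `s = ½` — positive by `re_half_deltaStar_pos` — is below `10⁻¹⁸`
(`≤ 2√y·q/(1−q)²` with `√y < 2.6563`, `q = e^{−2πy} ≤ e^{−44} < 8·10⁻²⁰`). [folklore] -/
theorem re_half_deltaStar_lt {F : ℂ → ℂ} (hF : IsZetaTwo deltaStar F) : (F (1 / 2)).re < 1e-18 := by
  refine (re_half_deltaStar_le hF).trans_lt ?_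
  set q : ℝ := Real.exp (-(2 * Real.pi * (1 / deltaStar))) with hq
  have hq0 : 0 < q := Real.exp_pos _
  have hq8 : q < 8e-20 := by
    refine lt_of_le_of_lt ?_ exp_neg_44_lt
    rw [hq, Real.exp_le_exp]
    linarith [fortyfour_le]
  have h1q : (1 - 8e-20 : ℝ) ^ 2 ≤ (1 - q) ^ 2 := by nlinarith
  have hs0 := Real.sqrt_nonneg (1 / deltaStar)
  have hnum : 2 * Real.sqrt (1 / deltaStar) * q < 2 * 2.6563 * 8e-20 := by
    have := sqrt_one_div_deltaStar_lt
    nlinarith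
  calc 2 * Real.sqrt (1 / deltaStar) * (q / (1 - q) ^ 2)
      = 2 * Real.sqrt (1 / deltaStar) * q / (1 - q) ^ 2 := by ring
    _ ≤ 2 * Real.sqrt (1 / deltaStar) * q / (1 - 8e-20) ^ 2 := by
        gcongr
    _ < 2 * 2.6563 * 8e-20 / (1 - 8e-20) ^ 2 := by gcongr
    _ < 1e-18 := by norm_num

/-- **`0 < ζ^{(2)}(½, e^γ/(4π)) < 10⁻¹⁸`** as a statement about the complex value: it is a positive
real number of modulus `< 10⁻¹⁸`. [folklore] -/
theorem norm_half_deltaStar_lt {F : ℂ → ℂ} (hF : IsZetaTwo deltaStar F) :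
    0 < (F (1 / 2)).re ∧ (F (1 / 2)).im = 0 ∧ ‖F (1 / 2)‖ < 1e-18 := by
  obtain ⟨hpos, him⟩ := re_half_deltaStar_pos hF
  refine ⟨hpos, him, ?_⟩
  have e : F (1 / 2) = ((F (1 / 2)).re : ℂ) :=
    Complex.ext (by rw [Complex.ofReal_re]) (by rw [Complex.ofReal_im, him])
  rw [e, Complex.norm_real, Real.norm_eq_abs, abs_of_pos hpos]
  exact re_half_deltaStar_lt hF

end Literature.NumberTheory.LFunctions.BeterminSamajTravenec2021

end
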